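/-
Origin: expansion seat `prover-pub-hodgecm-mc-sinst-1-g11-0`, handover #1258 2026-08-21T01:42Z md5 c2c07bffcb13 (125 l.; NEW additive leaf, ns HodgeCM.Model.ThetaAdelicSide: def thetaDistDatumTwoOf (Φarch) (harm : ∀ u ℓ, lineOmega_two V c.D hGR hGR₂ hGR₃ (eta₂ V c.D η) u (Φarch ℓ) = Φarch (weightOf.dual u ℓ)) (hdef : (c5) for lineRepOf … 2 at archToAdelic a, every ℓ Φf) : ThetaDistDatum (archSideOf V c hGR hGR₀ hGR₁ hGR₂ hGR₃ η hη hηc h₁W A) hV 2 := {ωA := lineOmega_two …, hA := lineRepOf_two_archInfOf_eq …, Uf := UfTwo c.D, toIdele := finLineTorusIdeles L (dW' c.D 0) (dW'_ne c.D 0), ωf := finRepTwo V c.D hGR hGR₂ hGR₃ (eta₂ V c.D η), fin_V/fin_W := #1257, smooth := finRepTwo_smooth … (continuous_cmConjEta₀ … η hηc) h₁W (archLineInput_Φinf_ne_zero … A 2)}; def thetaDistDatumThreeOf likewise (lineOmega_three, eta₃, hGR₃, UfThree, dW' c.D 1, continuous_cmConjEta₁_comp_snd, A 3); no theorems — defs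 only; NAMES for audit: none (2 defs)) (`HOME/mc/pub-hodgecm-mc-sinst-1-g11/stage69/HodgeCM/Model/AdelicThetaDistributionOf34.lean`, md5 c2c07bffcb13, 125 lines);
landed by the gen-29 packager (p-g29) in gate run 69 as `HodgeCM/Model/AdelicThetaDistributionOf34.lean` (verbatim).
-/
/-
Copyright (c) 2026 the pub-hodgecm formalisation cell (harness21).  New file, not vendored.
Origin: session prover-pub-hodgecm-mc-sinst-1-g11-0 (unit pub-hodgecm-mc-sinst-1-g11, S-INSTANCE CONSTRUCTOR gen 11; the HONEST INSTANCE of the (J4)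
product Weil datum at period-1's S pin term `archSideOf …`, slots 2 and 3 — the conjugated-plane clone of #1250 `Model/AdelicThetaDistributionOf`,
asked for by binder-1 (STATUS l.14897) ∕ model1 (l.14898 (5))), 2026-08-21.
Intended final place: `HodgeCM/Model/AdelicThetaDistributionOf34.lean` (NEW additive model-layer leaf; imports sinst-1's `Model/AdelicThetaDistributionOf`
(#1250: `archLineInput_Φinf_ne_zero`, #1246 `ThetaDistDatum`) and `Model/AdelicThetaDistributionFin34` (this kit); nothing imports it; drop alone).
-/
import Summits.HodgeConjecture.HodgeCM.Model.AdelicThetaDistributionOf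
import Summits.HodgeConjecture.HodgeCM.Model.AdelicThetaDistributionFin34_2

set_option autoImplicit false

/-!
# The honest (J4) product Weil datum of `archSideOf …`, slots 2 and 3

`ThetaAdelicSide.ThetaDistDatum (archSideOf V c hGR hGR₀ hGR₁ hGR₂ hGR₃ η hη hηc h₁W A) hV k`, k = 2, 3 (the lines `⟨a₂⟩`, `⟨a₃⟩` of the
CONJUGATED plane `isoGL · diag(a₂, a₃) · isoGL⁻¹`), ASSEMBLED exactly as #1250 assembles slots 0 ∕ 1:
* `ωA := lineOmega_two/three …` and `hA := lineRepOf_two/three_archInfOf_eq …` (carch `Model/ArchKTypeOfOmega`);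
* the FINITE half `Uf / toIdele / ωf / fin_V / fin_W / smooth` from `Model/AdelicThetaDistributionFin34` (`finRepTwo/Three`,
  `lineRepOf_k_finToG_eq_adelicTensorEnd`, `lineRepOf_k_one_finLineTorusIdeles_eq_adelicTensorEnd`, `finRep_k_smooth` with the nonzero archimedean
  vector `(A k).Φinf`);
* the ARCHIMEDEAN family `Φarch` with `harm` (under `lineOmega_two/three`) / `hdef` is taken as INPUT in carch's currency (the slot-2 ∕ 3
  `harm_lineOmega_two∕threeG`, `harch_two∕three_of_defType_tmulG` are carch's to deliver, binder-1 l.14897).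
KERNEL only: two `def`s (terms of an existing structure); 0 records, 0 `def … : Prop`, nothing cited.
-/

noncomputable section

open NumberField NumberField.mixedEmbedding IsDedekindDomain MulAction
open scoped Matrix TensorProduct Classical SchwartzMap
open Literature.NumberTheory.Automorphic Literature.NumberTheory.Weil1964
open Literature.NumberTheory.GelbartRogawski1991 Literature.NumberTheory.GelbartRogawski1991.UnitaryDualPair
open Literature.Geometry.ComplexHyperbolic.BallModel (U21 x₀)
open Literature.AlgebraicGeometry.ShimuraVarieties
open HodgeCM.Adelic HodgeCM.PerL34 HodgeCM.Model.ArchSideTerm HodgeCM.Model.ThetaDistFin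

namespace HodgeCM.Model
namespace ThetaAdelicSide

variable {L : CMField} {ι₁ : L →+* ℂ} (V : HermSpace3 L ι₁) (c : SeesawCtx L)
  (hGR : (cmSplittingDatum (L : Type) finProdFinEquiv (frameD V) (frameD_real V) (frameD_ne V) (dW c.D) (dW_real c.D)
    (dW_ne c.D)).CompatibleSplitting)
  (hGR₀ : (cmSplittingDatum (L : Type) (e₁) (frameD V) (frameD_real V) (frameD_ne V) (lineVec (L : Type) (dW c.D 0))
    (fun _ => dW_real c.D 0) (fun _ => dW_ne c.D 0)).CompatibleSplitting)
  (hGR₁ : (cmSplittingDatum (L : Type) (e₁) (frameD V) (frameD_real V) (frameD_ne V) (lineVec (L : Type) (dW c.D 1))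
    (fun _ => dW_real c.D 1) (fun _ => dW_ne c.D 1)).CompatibleSplitting)
  (hGR₂ : (cmSplittingDatum (L : Type) (e₁) (frameD V) (frameD_real V) (frameD_ne V) (lineVec (L : Type) (dW' c.D 0))
    (fun _ => dW'_real c.D 0) (fun _ => dW'_ne c.D 0)).CompatibleSplitting)
  (hGR₃ : (cmSplittingDatum (L : Type) (e₁) (frameD V) (frameD_real V) (frameD_ne V) (lineVec (L : Type) (dW' c.D 1))
    (fun _ => dW'_real c.D 1) (fun _ => dW'_ne c.D 1)).CompatibleSplitting)
  (η : CMAdelic (L : Type) (frameD V) × CMAdelic (L : Type) (dW c.D) →* ℂˣ)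
  (hη : ∀ γU ∈ CMRat (L : Type) (frameD V), ∀ γ ∈ CMRat (L : Type) (dW c.D), η (γU, γ) = 1)
  (hηc : Continuous fun p => ((η p : ℂˣ) : ℂ))
  (h₁W : (∀ j, 0 < (ι₁ (dW c.D j)).re) ∨ ∀ j, (ι₁ (dW c.D j)).re < 0)
  (A : ∀ k : Fin 4, ArchLineInput V (lineRepD V c.D hGR hGR₀ hGR₁ hGR₂ hGR₃ η k))
  (hV : IsAnisotropic L V.Hm)

/-- **THE HONEST (J4) PRODUCT WEIL DATUM OF SLOT 2** at `archSideOf …` (the conjugated-plane line `⟨a₂⟩`, `a₂ = dW' c.D 0`), given the harmonic family `Φarch`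
with its `harm` (under `lineOmega_two`) and `hdef` ((c5) for every finite vector) in carch's currency. -/
def thetaDistDatumTwoOf (Φarch : Module.Dual ℂ (Fin 2 → ℂ) →ₗ[ℂ] 𝓢((Fin 3 → mixedSpace (↥(maximalRealSubfield L))), ℂ))
    (harm : ∀ (u : ↥(stabilizer U21 x₀)) (ℓ : Module.Dual ℂ (Fin 2 → ℂ)),
      lineOmega_two V c.D hGR hGR₂ hGR₃ (eta₂ V c.D η) (u : U21) (Φarch ℓ) =
        Φarch ((BallForms.isPullbackCocycle_cotangentCocycle.weightOf x₀).dual u ℓ))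
    (hdef : ∀ a : UnitaryGroup.arch (↥(maximalRealSubfield L)) L (IsCMField.complexConj L) 3 V.Hm,
      UnitaryGroup.archAt (↥(maximalRealSubfield L)) L (IsCMField.complexConj L) 3 V.Hm (UnitaryGroup.cmPlace (L : Type) ι₁)
          (NumberField.complexConj_smul_infinitePlace (L : Type) _) (IsCMField.complexConj_ne_one (L : Type)) a = 1 →
      ∀ (ℓ : Module.Dual ℂ (Fin 2 → ℂ)) (Φf : FinSB (↥(maximalRealSubfield L)) (Fin 3)),
        lineRepOf V c.D hGR hGR₀ hGR₁ hGR₂ hGR₃ (eta₀ V c.D η) (eta₁ V c.D η) (eta₂ V c.D η) (eta₃ V c.D η) 2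
            (HodgeCM.Adelic.regimeEquiv L V.Hm hV
              (UnitaryGroup.archToAdelic (↥(maximalRealSubfield L)) L (IsCMField.complexConj L) 3 V.Hm a), 1)
            (piSchwartzBruhatEquiv (↥(maximalRealSubfield L)) (Fin 3) (Φarch ℓ ⊗ₜ[ℂ] Φf)) =
          piSchwartzBruhatEquiv (↥(maximalRealSubfield L)) (Fin 3) (Φarch ℓ ⊗ₜ[ℂ] Φf)) :
    ThetaDistDatum (archSideOf V c hGR hGR₀ hGR₁ hGR₂ hGR₃ η hη hηc h₁W A) hV 2 where
  ωA := lineOmega_two V c.D hGR hGR₂ hGR₃ (eta₂ V c.D η)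
  hA g := lineRepOf_two_archInfOf_eq V c.D hGR hGR₀ hGR₁ hGR₂ hGR₃ (eta₀ V c.D η) (eta₁ V c.D η) (eta₂ V c.D η) (eta₃ V c.D η) hV g
  Φarch := Φarch
  harm := harm
  hdef := hdef
  Uf := UfTwo c.D
  toIdele := finLineTorusIdeles (L : Type) (dW' c.D 0) (dW'_ne c.D 0)
  ωf := finRepTwo V c.D hGR hGR₂ hGR₃ (eta₂ V c.D η)
  fin_V g := lineRepOf_two_finToG_eq_adelicTensorEnd V c.D hGR hGR₀ hGR₁ hGR₂ hGR₃ (eta₀ V c.D η) (eta₁ V c.D η) (eta₂ V c.D η)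
    (eta₃ V c.D η) hV g
  fin_W u := lineRepOf_two_one_finLineTorusIdeles_eq_adelicTensorEnd V c.D hGR hGR₀ hGR₁ hGR₂ hGR₃ (eta₀ V c.D η) (eta₁ V c.D η)
    (eta₂ V c.D η) (eta₃ V c.D η) u
  smooth Φf := finRepTwo_smooth V c.D hGR hGR₂ hGR₃ (eta₂ V c.D η)
    (continuous_cmConjEta₀ (L : Type) (frameD V) (dW c.D) (dW' c.D) c.D.isoGL (isoGL_hg₀ c.D) η hηc) h₁W
    (archLineInput_Φinf_ne_zero V c hGR hGR₀ hGR₁ hGR₂ hGR₃ η A 2) Φf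

/-- **THE HONEST (J4) PRODUCT WEIL DATUM OF SLOT 3** at `archSideOf …` (the conjugated-plane line `⟨a₃⟩`, `a₃ = dW' c.D 1`). -/
def thetaDistDatumThreeOf (Φarch : Module.Dual ℂ (Fin 2 → ℂ) →ₗ[ℂ] 𝓢((Fin 3 → mixedSpace (↥(maximalRealSubfield L))), ℂ))
    (harm : ∀ (u : ↥(stabilizer U21 x₀)) (ℓ : Module.Dual ℂ (Fin 2 → ℂ)),
      lineOmega_three V c.D hGR hGR₂ hGR₃ (eta₃ V c.D η) (u : U21) (Φarch ℓ) =
        Φarch ((BallForms.isPullbackCocycle_cotangentCocycle.weightOf x₀).dual u ℓ))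
    (hdef : ∀ a : UnitaryGroup.arch (↥(maximalRealSubfield L)) L (IsCMField.complexConj L) 3 V.Hm,
      UnitaryGroup.archAt (↥(maximalRealSubfield L)) L (IsCMField.complexConj L) 3 V.Hm (UnitaryGroup.cmPlace (L : Type) ι₁)
          (NumberField.complexConj_smul_infinitePlace (L : Type) _) (IsCMField.complexConj_ne_one (L : Type)) a = 1 →
      ∀ (ℓ : Module.Dual ℂ (Fin 2 → ℂ)) (Φf : FinSB (↥(maximalRealSubfield L)) (Fin 3)),
        lineRepOf V c.D hGR hGR₀ hGR₁ hGR₂ hGR₃ (eta₀ V c.D η) (eta₁ V c.D η) (eta₂ V c.D η) (eta₃ V c.D η) 3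
            (HodgeCM.Adelic.regimeEquiv L V.Hm hV
              (UnitaryGroup.archToAdelic (↥(maximalRealSubfield L)) L (IsCMField.complexConj L) 3 V.Hm a), 1)
            (piSchwartzBruhatEquiv (↥(maximalRealSubfield L)) (Fin 3) (Φarch ℓ ⊗ₜ[ℂ] Φf)) =
          piSchwartzBruhatEquiv (↥(maximalRealSubfield L)) (Fin 3) (Φarch ℓ ⊗ₜ[ℂ] Φf)) :
    ThetaDistDatum (archSideOf V c hGR hGR₀ hGR₁ hGR₂ hGR₃ η hη hηc h₁W A) hV 3 where
  ωA := lineOmega_three V c.D hGR hGR₂ hGR₃ (eta₃ V c.D η)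
  hA g := lineRepOf_three_archInfOf_eq V c.D hGR hGR₀ hGR₁ hGR₂ hGR₃ (eta₀ V c.D η) (eta₁ V c.D η) (eta₂ V c.D η) (eta₃ V c.D η) hV g
  Φarch := Φarch
  harm := harm
  hdef := hdef
  Uf := UfThree c.D
  toIdele := finLineTorusIdeles (L : Type) (dW' c.D 1) (dW'_ne c.D 1)
  ωf := finRepThree V c.D hGR hGR₂ hGR₃ (eta₃ V c.D η)
  fin_V g := lineRepOf_three_finToG_eq_adelicTensorEnd V c.D hGR hGR₀ hGR₁ hGR₂ hGR₃ (eta₀ V c.D η) (eta₁ V c.D η) (eta₂ V c.D η)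
    (eta₃ V c.D η) hV g
  fin_W u := lineRepOf_three_one_finLineTorusIdeles_eq_adelicTensorEnd V c.D hGR hGR₀ hGR₁ hGR₂ hGR₃ (eta₀ V c.D η) (eta₁ V c.D η)
    (eta₂ V c.D η) (eta₃ V c.D η) u
  smooth Φf := finRepThree_smooth V c.D hGR hGR₂ hGR₃ (eta₃ V c.D η)
    (continuous_cmConjEta₁_comp_snd (L : Type) (frameD V) (dW c.D) (dW' c.D) c.D.isoGL (isoGL_hg₀ c.D) η hηc)
    (archLineInput_Φinf_ne_zero V c hGR hGR₀ hGR₁ hGR₂ hGR₃ η A 3) Φf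

end ThetaAdelicSide
end HodgeCM.Model

end
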